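import Mathlib

/-!
# Square-zero factorisation (`stub_squareZeroFactor`)

A complex `3 × 3` matrix `N` with `N² = 0` is either `0` or a rank-one outer product `u wᵀ`
(`Matrix.vecMulVec u w`) with `u ≠ 0`, `w ≠ 0` and `wᵀ u = 0`.

Proof: `N² = 0` gives `range N ≤ ker N`, so by rank–nullity `2 · rank N ≤ 3`, i.e. `rank N ≤ 1`,
whence the column space is a line `ℂ u` and `N = u wᵀ`; then `N² = (wᵀ u) • N = 0` with
`N ≠ 0` forces `wᵀ u = 0`.
-/

set_option linter.dupNamespace false

namespace Summit.ValiantsHypothesis.ValiantsHypothesis.Theorems.WordPerSuperQuartic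

open Matrix Module

/-- A square-zero `3 × 3` complex matrix has rank at most `1` (rank–nullity: its range lies in
its kernel). -/
private theorem squareZeroFactor_rank_le_one (N : Matrix (Fin 3) (Fin 3) ℂ) (hN : N * N = 0) :
    N.rank ≤ 1 := by
  have hle : LinearMap.range N.mulVecLin ≤ LinearMap.ker N.mulVecLin := by
    rintro _ ⟨x, rfl⟩
    simp [Matrix.mulVec_mulVec, hN]
  have h1 := LinearMap.finrank_range_add_finrank_ker N.mulVecLin
  have h2 := Submodule.finrank_mono hle
  rw [Module.finrank_fin_fun] at h1
  unfold Matrix.rank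
  omega

/-- A matrix of rank `≤ 1` over `ℂ` is an outer product `a bᵀ`: its column space is spanned by
one vector `a`, and column `j` is `b j • a`. -/
private theorem squareZeroFactor_exists_vecMulVec {m n : Type*} [Fintype m] [Fintype n]
    [DecidableEq n] (M : Matrix m n ℂ) (hM : M.rank ≤ 1) :
    ∃ (a : m → ℂ) (b : n → ℂ), M = Matrix.vecMulVec a b := by
  obtain ⟨v, hv⟩ := finrank_le_one_iff.1 hM
  have hcol : ∀ j, ∃ c : ℂ, c • (v : m → ℂ) = M.col j := by
    intro j
    have hmem : M.col j ∈ LinearMap.range M.mulVecLin :=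
      ⟨Pi.single j 1, by rw [Matrix.mulVecLin_apply, Matrix.mulVec_single_one]⟩
    obtain ⟨c, hc⟩ := hv ⟨M.col j, hmem⟩
    exact ⟨c, by simpa using congrArg Subtype.val hc⟩
  choose c hc using hcol
  refine ⟨v, c, ?_⟩
  ext i j
  have h := congrFun (hc j) i
  simp only [Pi.smul_apply, smul_eq_mul, Matrix.col_apply] at h
  rw [Matrix.vecMulVec_apply, ← h, mul_comm]

/-- **Square-zero factorisation**: a square-zero complex `3 × 3` matrix is `0` or a rank-one
product `u wᵀ` with `u ≠ 0`, `w ≠ 0` and `wᵀ u = 0`. -/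
theorem stub_squareZeroFactor (N : Matrix (Fin 3) (Fin 3) ℂ) (hN : N * N = 0) :
    N = 0 ∨ ∃ u w : Fin 3 → ℂ, u ≠ 0 ∧ w ≠ 0 ∧ w ⬝ᵥ u = 0 ∧ N = Matrix.vecMulVec u w := by
  obtain ⟨u, w, rfl⟩ :=
    squareZeroFactor_exists_vecMulVec N (squareZeroFactor_rank_le_one N hN)
  by_cases huw : Matrix.vecMulVec u w = 0
  · exact Or.inl huw
  right
  have hu : u ≠ 0 := fun h => huw (by simp [h])
  have hw : w ≠ 0 := fun h => huw (by simp [h])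
  refine ⟨u, w, hu, hw, ?_, rfl⟩
  rw [Matrix.vecMulVec_mul_vecMulVec, Matrix.vecMulVec_smul] at hN
  exact (smul_eq_zero.mp hN).resolve_right huw

end Summit.ValiantsHypothesis.ValiantsHypothesis.Theorems.WordPerSuperQuartic
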